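import Summits.NavierStokesRegularity.NavierStokesRegularity.Theorems.TautCompressionIntegrable.Negative.TautLoopSpaceTools
import Literature.Analysis.FluidPDE.TypeIAncientMild
import Literature.Analysis.FluidPDE.OseenDuhamelPairCalculus

/-!
# Sketch — crux idea `kelvin-leray-locking` (crux `TautCompressionIntegrable`, stmt-15248, round 2, k4)

First-lemma signatures of the line, stated over existing declarations only. Nothing here asserts a
Theses statement; every `def` is a `Prop`.

* `SubQuantumCircles v ρ ε` — every planar circle of radius `≤ ρ` has `|∮ v·dl| ≤ ε`.
* `SingleSliceBootstrap` — **L3, the lever's engine**: a bounded Oseen-mild field on `[0,S) × ℝ³`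
  whose initial slice is `a`-small in `Ḃ^{-1}_{∞,∞}` (caloric form `√τ ‖e^{τΔ}V(0)‖_∞ ≤ a`) obeys the
  critical decay `‖V(t)‖_∞ ≤ 2a/√t` on the window `[4a²/M², (4a²/M²)·exp(1/(K a))]`.
* `KelvinLerayLocking` — Type-I blow-up forces, at EVERY late time, a quantum circle
  (`|∮u·dl| > ε ν`) of radius `≤ R √(ν (T - t))`, with `ε, R` depending on the Type-I constant only.
* `KelvinSmallLiouville` — the ancient corollary: a Type-I ancient mild field whose similarity-size
  circles are sub-quantum along a sequence `s → -∞` vanishes.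
* `SimilarityOverStrain` — the corollary through `TautLoopLaw`: in a Type-I blow-up every measurable
  majorant `Φ` of the crux's functional `Λ_g` (`nearTautRate`, verbatim the crux's expression) has
  `∫_{t₂}^{t₃} Φ⁺ ≥ ½ log((T-t₂)/(T-t₃)) - A` on every late interval.
-/

noncomputable section

namespace Summit.NavierStokesRegularity.NavierStokesRegularity.Cruxes.TautCompressionIntegrable.KelvinLerayLocking

open MeasureTheory Set Filter Metric Real
open scoped ENNReal Topology
open Literature.Analysis.FluidPDE
open Summit.NavierStokesRegularity.NavierStokesRegularity.Theorems.TautCompressionIntegrable.Negative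
  (nearTautRate)

local notation "ℝ³" => EuclideanSpace ℝ (Fin 3)

/-- Every planar circle (orthonormal-frame encoding of the route, `circleLoop c r e₁ e₂`) of radius
`0 < r ≤ ρ` has `|∮ v·dl| ≤ ε`. -/
def SubQuantumCircles (v : ℝ³ → ℝ³) (ρ ε : ℝ) : Prop :=
  ∀ (c e₁ e₂ : ℝ³) (r : ℝ), ‖e₁‖ = 1 → ‖e₂‖ = 1 → inner ℝ e₁ e₂ = 0 → 0 < r → r ≤ ρ →
    |circulation v (circleLoop c r e₁ e₂)| ≤ ε

/-- **L3 · single-slice Besov bootstrap** (unit viscosity). There are absolute `a₀, K > 0` such that: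
if `V` is jointly continuous and bounded by `M` on `[0,S) × ℝ³`, satisfies the Oseen integral
equation from the slice `0`, and `√τ‖e^{τΔ}V(0)‖_∞ ≤ a ≤ a₀` for all `τ > 0`, then
`‖V(t)‖_∞ ≤ 2a/√t` for `t ∈ [4a²/M², (4a²/M²) exp(1/(K a))] ∩ (0,S)`. -/
def SingleSliceBootstrap : Prop :=
  ∃ a₀ : ℝ, 0 < a₀ ∧ ∃ K : ℝ, 0 < K ∧
    ∀ (a M S : ℝ) (V : ℝ → ℝ³ → ℝ³), 0 < a → a ≤ a₀ → 0 < M → 0 < S →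
      ContinuousOn (Function.uncurry V) (Set.Ico 0 S ×ˢ Set.univ) →
      (∀ t ∈ Set.Ico 0 S, ∀ x, ‖V t x‖ ≤ M) →
      (∀ t ∈ Set.Ioo 0 S, ∀ x,
        V t x = Literature.Analysis.UnboundedOperators.heatExtension (V 0) t x - oseenDuhamel 1 0 V V t x) →
      (∀ τ : ℝ, 0 < τ → ∀ x,
        ‖Literature.Analysis.UnboundedOperators.heatExtension (V 0) τ x‖ ≤ a / Real.sqrt τ) →
      ∀ t ∈ Set.Ioo 0 S, 4 * a ^ 2 / M ^ 2 ≤ t → t ≤ (4 * a ^ 2 / M ^ 2) * Real.exp (1 / (K * a)) →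
        ∀ x, ‖V t x‖ ≤ 2 * a / Real.sqrt t

/-- **Kelvin–Leray locking.** For every Type-I constant `C` there are `ε, R > 0` such that every
classical Leray–Hopf solution from a rapidly decaying datum on `[0,T)` which does NOT extend past `T`
and obeys `√(T-t)‖u(t)‖_∞ ≤ C√ν` carries, at every time of a final interval `(t₁, T)`, a planar circle
of radius `≤ R√(ν(T-t))` with `|∮ u(t)·dl| > ε ν`. -/
def KelvinLerayLocking : Prop :=
  ∀ C : ℝ, 0 < C → ∃ ε R : ℝ, 0 < ε ∧ 0 < R ∧
    ∀ (ν T : ℝ), 0 < ν → 0 < T → ∀ (u : ℝ → ℝ³ → ℝ³) (p : ℝ → ℝ³ → ℝ),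
      IsClassicalNSSolutionOn (Set.Ico 0 T) ν 0 u p → IsLerayHopfOn T ν 0 (u 0) u →
      HasRapidSpatialDecay (u 0) → ¬ HasSmoothExtensionPast ν 0 u T →
      (∀ t ∈ Set.Ico 0 T, ∀ x, Real.sqrt (T - t) * ‖u t x‖ ≤ C * Real.sqrt ν) →
      ∃ t₁ : ℝ, t₁ < T ∧ ∀ t ∈ Set.Ioo t₁ T,
        ∃ (c e₁ e₂ : ℝ³) (r : ℝ), ‖e₁‖ = 1 ∧ ‖e₂‖ = 1 ∧ inner ℝ e₁ e₂ = 0 ∧ 0 < r ∧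
          r ≤ R * Real.sqrt (ν * (T - t)) ∧ ε * ν < |circulation (u t) (circleLoop c r e₁ e₂)|

/-- **Kelvin-small Liouville** (ancient corollary, unit viscosity). For every `C` there is `ε > 0`
such that a Type-I ancient mild field of constant `C` whose circles of radius `≤ R√(-s)` are all
`ε`-sub-quantum at arbitrarily negative times, for every `R`, vanishes identically. -/
def KelvinSmallLiouville : Prop :=
  ∀ C : ℝ, 0 < C → ∃ ε : ℝ, 0 < ε ∧ ∀ (U : ℝ → ℝ³ → ℝ³), IsTypeIAncientMild C U →
    (∀ R : ℝ, 0 < R → ∀ s₀ : ℝ, s₀ < 0 → ∃ s : ℝ, s < s₀ ∧ SubQuantumCircles (U s) (R * Real.sqrt (-s)) ε) →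
    ∀ s : ℝ, s < 0 → ∀ x, U s x = 0

/-- **SimilarityOverStrain** (corollary of locking through `TautLoopLaw`). In a Type-I blow-up, for
every small level `0 < g ≤ g₀ν`, every measurable majorant `Φ` of the crux's near-taut compression
rate `Λ_g(s) = nearTautRate (u s) g` on a final interval satisfies
`½ log((T-t₂)/(T-t₃)) - A ≤ ∫_{(t₂,t₃)} Φ⁺` for all `t₁ < t₂ < t₃ < T`. -/
def SimilarityOverStrain : Prop :=
  ∀ C : ℝ, 0 < C → ∃ g₀ : ℝ, 0 < g₀ ∧
    ∀ (ν T : ℝ), 0 < ν → 0 < T → ∀ (u : ℝ → ℝ³ → ℝ³) (p : ℝ → ℝ³ → ℝ),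
      IsClassicalNSSolutionOn (Set.Ico 0 T) ν 0 u p → IsLerayHopfOn T ν 0 (u 0) u →
      HasRapidSpatialDecay (u 0) → ¬ HasSmoothExtensionPast ν 0 u T →
      (∀ t ∈ Set.Ico 0 T, ∀ x, Real.sqrt (T - t) * ‖u t x‖ ≤ C * Real.sqrt ν) →
      ∀ g : ℝ, 0 < g → g ≤ g₀ * ν → ∃ A t₁ : ℝ, 0 ≤ t₁ ∧ t₁ < T ∧
        ∀ Φ : ℝ → ℝ, Measurable Φ → (∀ s ∈ Set.Ioo t₁ T, nearTautRate (u s) g ≤ Φ s) →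
          ∀ t₂ t₃ : ℝ, t₁ < t₂ → t₂ < t₃ → t₃ < T →
            ENNReal.ofReal ((1 / 2) * Real.log ((T - t₂) / (T - t₃)) - A) ≤
              ∫⁻ s in Set.Ioo t₂ t₃, ENNReal.ofReal (Φ s)

/-- Sanity: `SimilarityOverStrain` contradicts the crux's conclusion on Type-I blow-ups — recorded as
the shape of the implication the line proves (`K1 ∧ SOS ⇒ no Type-I blow-up in the class`). -/
def TypeIExcludedShape : Prop :=
  Summit.NavierStokesRegularity.NavierStokesRegularity.Theses.TautLoopKelvin.TautCompressionIntegrable →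
    SimilarityOverStrain →
    ∀ C : ℝ, 0 < C → ∀ (ν T : ℝ), 0 < ν → 0 < T → ∀ (u : ℝ → ℝ³ → ℝ³) (p : ℝ → ℝ³ → ℝ),
      IsClassicalNSSolutionOn (Set.Ico 0 T) ν 0 u p → IsLerayHopfOn T ν 0 (u 0) u →
      HasRapidSpatialDecay (u 0) →
      (∀ t ∈ Set.Ico 0 T, ∀ x, Real.sqrt (T - t) * ‖u t x‖ ≤ C * Real.sqrt ν) →
      HasSmoothExtensionPast ν 0 u T

/-- **Kernel-checked composition of the easy end of the line**: the crux `K1` together with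
`SimilarityOverStrain` excludes Type-I blow-up in the route's class (pure bookkeeping: the crux's
`Φ` has `∫⁻ Φ⁺ ≤ M` on `(0,T)`, while SOS forces `∫⁻_{(t₂,t₃)} Φ⁺ ≥ |M| + 1` on a late interval). -/
theorem typeIExcluded_of_K1_SOS : TypeIExcludedShape := by
  intro hK1 hSOS C hC ν T hν hT u p hsol hLH hdec hTypeI
  by_contra hnot
  obtain ⟨g₀, hg₀, hS⟩ := hSOS C hC
  have hg : 0 < g₀ * ν := mul_pos hg₀ hν
  obtain ⟨A, t₁, ht₁0, ht₁, hA⟩ := hS ν T hν hT u p hsol hLH hdec hnot hTypeI (g₀ * ν) hg le_rfl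
  obtain ⟨Φ, M, hΦm, hM, hΦ, hint⟩ := hK1 ν T hν hT u p hsol hLH hdec (g₀ * ν) hg
  have hmaj : ∀ s ∈ Set.Ioo t₁ T, nearTautRate (u s) (g₀ * ν) ≤ Φ s := fun s hs =>
    hΦ s ⟨ht₁0.trans_lt hs.1, hs.2⟩
  -- a late interval `(t₂, t₃) ⊆ (t₁, T)` of logarithmic length `2 L`, `L = |M| + |A| + 1`
  set t₂ : ℝ := (t₁ + T) / 2 with ht₂
  have ht₁2 : t₁ < t₂ := by rw [ht₂]; linarith
  have ht₂T : t₂ < T := by rw [ht₂]; linarith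
  have hTt₂ : 0 < T - t₂ := sub_pos.2 ht₂T
  set L : ℝ := |M| + |A| + 1 with hL
  have hL0 : 0 < L := by positivity
  set t₃ : ℝ := T - (T - t₂) * Real.exp (-(2 * L)) with ht₃
  have hexp1 : Real.exp (-(2 * L)) < 1 := Real.exp_lt_one_iff.2 (by linarith)
  have ht₃T : t₃ < T := by
    have := mul_pos hTt₂ (Real.exp_pos (-(2 * L)))
    rw [ht₃]; linarith
  have ht₂3 : t₂ < t₃ := by
    have : (T - t₂) * Real.exp (-(2 * L)) < (T - t₂) * 1 := mul_lt_mul_of_pos_left hexp1 hTt₂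
    rw [ht₃]; linarith
  have hlog : Real.log ((T - t₂) / (T - t₃)) = 2 * L := by
    have h3 : T - t₃ = (T - t₂) * Real.exp (-(2 * L)) := by rw [ht₃]; ring
    rw [h3, Real.exp_neg, ← div_div, div_self hTt₂.ne', one_div, inv_inv, Real.log_exp]
  have hlow := hA Φ hΦm hmaj t₂ t₃ ht₁2 ht₂3 ht₃T
  rw [hlog] at hlow
  have hsub : Set.Ioo t₂ t₃ ⊆ Set.Ioo 0 T := fun s hs =>
    ⟨(ht₁0.trans_lt ht₁2).trans hs.1, hs.2.trans ht₃T⟩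
  have hchain : ENNReal.ofReal (1 / 2 * (2 * L) - A) ≤ ENNReal.ofReal M :=
    hlow.trans ((lintegral_mono_set hsub).trans hint)
  rw [ENNReal.ofReal_le_ofReal_iff hM] at hchain
  have h1 : M ≤ |M| := le_abs_self M
  have h2 : A ≤ |A| := le_abs_self A
  rw [hL] at hchain
  linarith

end Summit.NavierStokesRegularity.NavierStokesRegularity.Cruxes.TautCompressionIntegrable.KelvinLerayLocking
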